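import Mathlib
import Summits.Ventures.PercRepro2.Defs
import Summits.Ventures.PercRepro2.Independence
import Summits.Ventures.PercRepro2.Harris
import Summits.Ventures.PercRepro2.Graph
import Summits.Ventures.PercRepro2.Exploration
import Summits.Ventures.PercRepro2.Events
import Summits.Ventures.PercRepro2.ObsIndependence
import Summits.Ventures.PercRepro2.BHKEvents
import Summits.Ventures.PercRepro2.CDRequired
import Summits.Ventures.PercRepro2.GateCylinder
import Summits.Ventures.PercRepro2.CutVertexDefs
import Summits.Ventures.PercRepro2.CDCylinder

/-!
# Row 2′CD across a cut vertex separating `a₁` from `{a₂, o}` (blind cell PercRepro2, mine-a g33;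
MINE-A.md §88.7)

Let `y` be a cut vertex (`CutV.IsCut ends y VA VB EA EB`) with `a₁ ∈ VA ∪ {y}` and `a₂, o ∈ VB`, and let
`a₃ ∈ VB ∪ {y}` with `{y ↔ a₃}` a cylinder `{every edge of B open}` — `a₃ = y` itself (`B = ∅`), or `a₃`
joined to `y` by a unique path of bridges.  Then row 2′CD holds for every up-set `𝓔` and every weight
vector (`cd_of_cut_cylinder`; `cd_of_cut_vertex` is the case `a₃ = y`, `cd_of_cut_at_root` the case
`a₁ = y`: `a₃` in a pocket hanging at the root).

Proof.  By `CDRequired.cd_of_required_anticorr` it suffices to prove the `a₃`-required anti-correlation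
`P(Q U e f) · P(Q e) ≤ P(Q U e) · P(Q e f)`.  Condition on the `A`-side configuration `T = restrict EA ω`
(`ObsIndependence.expect_tower`, the two sides being independent): on `{a₁ ↔ y in A}` the root cluster is
`C_A(a₁) ∪ C_B(y)`, `Q = {y ↮ a₂ in B}`, `e = {y ↔ a₃ in B}`, `f = {a₂ ↔ o in B}`, so each of the four
probabilities is `∑_ω weight p ω · 1_{a₁ ↔ y}(T) · P_p(far-side event)`, the far-side events being those
of the cylinder theorem with the root `y` and the up-set `𝓔_T = {W ∣ C_A(a₁)(T) ∪ W ∈ 𝓔}`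
(`required_events_eq`, `prob_eq_sum_tower`).  A far-side probability is a probability under the weight
vector with the `A`-edges closed (`prob_zeroOff_eq_prob_sideEvent`), where
`CDCylinder.required_anticorr_of_cylinder` (root `y`, cylinder `B`) is exactly the fibrewise inequality
(`bside_anticorr`); the factors `P(Q e)`, `P(Q e f)` do not depend on `T`, so the fibrewise inequalities
add up (`required_anticorr_of_cut_cylinder`).  In the lens: the `a₃`-first revealment of `C₁` passes
through `y`, and the between-fibre covariance vanishes.  No definition; one seat.
-/

namespace Summit.Ventures.PercRepro2

namespace CDCutVertex

/-! ## Probabilities read on one side of a cut -/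
section Side

variable {E : Type*} [Fintype E] [DecidableEq E] {R : Type*} [CommRing R]

omit [DecidableEq E] in
/-- The weight of a configuration with an open edge off `F` vanishes under the vector that closes the
edges off `F`. -/
lemma weight_zeroOff_eq_zero (p : E → R) (F : Set E) [DecidablePred (· ∈ F)] {ω : Config E}
    {e : E} (he : e ∉ F) (hω : ω e = true) :
    weight (fun e' => if e' ∈ F then p e' else 0) ω = 0 := by
  unfold weight
  exact Finset.prod_eq_zero (Finset.mem_univ e) (by simp [he, hω])

omit [Fintype E] [DecidableEq E] in
/-- A configuration closed off `F` is its own restriction to `F`. -/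
lemma restrict_eq_self_of_closed (F : Set E) [DecidablePred (· ∈ F)] {ω : Config E}
    (hω : ∀ e, e ∉ F → ω e = false) : restrict F ω = ω := by
  funext e
  by_cases he : e ∈ F
  · rw [restrict_apply_of_mem he]
  · rw [restrict_apply_of_notMem he, hω e he]

/-- **Only the weights on `F` matter for an event determined by `F`.** -/
theorem prob_eq_of_dependsOn (p q : E → R) (F : Set E) [DecidablePred (· ∈ F)]
    {Y : Set (Config E)} (hY : DependsOn (· ∈ Y) F) (hpq : ∀ e ∈ F, p e = q e) :
    prob p Y = prob q Y := by
  let a : ({e // e ∈ F} → Bool) → R := fun σ₁ => Y.indicator 1 (glue F σ₁ fun _ => false)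
  have ha : ∀ σ₁ σ₂, Y.indicator (1 : Config E → R) (glue F σ₁ σ₂) = a σ₁ := by
    intro σ₁ σ₂
    have hiff : glue F σ₁ σ₂ ∈ Y ↔ glue F σ₁ (fun _ => false) ∈ Y :=
      dependsOn_mem_iff hY fun i hi => by rw [glue_apply_of_mem F _ _ hi, glue_apply_of_mem F _ _ hi]
    by_cases h : glue F σ₁ σ₂ ∈ Y
    · simp [a, h, hiff.1 h]
    · have h2 : glue F σ₁ (fun _ => false) ∉ Y := fun h' => h (hiff.2 h')
      simp [a, h, h2]
  have key : ∀ r : E → R, prob r Y = ∑ σ₁, weight (fun i : {e // e ∈ F} => r i) σ₁ * a σ₁ := by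
    intro r
    rw [prob_eq_expect_indicator, expect_eq_sum_glue r _ F]
    refine Finset.sum_congr rfl fun σ₁ _ => ?_
    calc ∑ σ₂, weight (fun i : {e // e ∈ F} => r i) σ₁ * weight (fun i : {e // e ∉ F} => r i) σ₂
          * Y.indicator 1 (glue F σ₁ σ₂)
        = ∑ σ₂, (weight (fun i : {e // e ∈ F} => r i) σ₁ * a σ₁) *
            weight (fun i : {e // e ∉ F} => r i) σ₂ :=
          Finset.sum_congr rfl fun σ₂ _ => by rw [ha]; ring
      _ = weight (fun i : {e // e ∈ F} => r i) σ₁ * a σ₁ := by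
          rw [← Finset.mul_sum, sum_weight, mul_one]
  rw [key p, key q]
  have hw : (fun i : {e // e ∈ F} => p i) = fun i : {e // e ∈ F} => q i := by
    funext i; exact hpq i i.2
  rw [hw]

/-- **A side probability is a probability with the other side closed**:
`P_{p[off F ↦ 0]}(X) = P_p(restrict F ω ∈ X)`. -/
theorem prob_zeroOff_eq_prob_sideEvent (p : E → R) (F : Set E) [DecidablePred (· ∈ F)]
    (X : Set (Config E)) :
    prob (fun e => if e ∈ F then p e else 0) X = prob p (CutV.sideEvent F X) := by
  have h1 : prob (fun e => if e ∈ F then p e else 0) X =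
      prob (fun e => if e ∈ F then p e else 0) (CutV.sideEvent F X) := by
    unfold prob
    refine Finset.sum_congr rfl fun ω _ => ?_
    by_cases hω : ∀ e, e ∉ F → ω e = false
    · have hr : restrict F ω = ω := restrict_eq_self_of_closed F hω
      have hmem : ω ∈ CutV.sideEvent F X ↔ ω ∈ X := by
        rw [CutV.mem_sideEvent, hr]
      by_cases hX : ω ∈ X
      · rw [Set.indicator_of_mem hX, Set.indicator_of_mem (hmem.2 hX)]
      · rw [Set.indicator_of_notMem hX, Set.indicator_of_notMem (fun h => hX (hmem.1 h))]
    · push Not at hω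
      obtain ⟨e, he, hωe⟩ := hω
      have hz : weight (fun e' => if e' ∈ F then p e' else 0) ω = 0 :=
        weight_zeroOff_eq_zero p F he (by simpa using hωe)
      rw [Set.indicator_apply_eq_zero.2 (fun _ => hz), Set.indicator_apply_eq_zero.2 (fun _ => hz)]
  rw [h1]
  exact prob_eq_of_dependsOn _ p F (CutV.dependsOn_sideEvent F X) fun e he => by simp [he]

omit [Fintype E] [DecidableEq E] in
/-- Closing the edges off `F` keeps the weights admissible. -/
lemma isProbVec_zeroOff [PartialOrder R] [IsOrderedRing R] {p : E → R} (hp : IsProbVec p)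
    (F : Set E) [DecidablePred (· ∈ F)] :
    IsProbVec (fun e => if e ∈ F then p e else 0) := by
  refine ⟨fun e => ?_, fun e => ?_⟩ <;> by_cases h : e ∈ F <;>
    simp [h, hp.nonneg e, hp.le_one e]

end Side

/-! ## The far-side inequality, the tower over the near side, and the theorem -/
section Main

variable {V : Type*} {E : Type*} [Fintype E] [DecidableEq E] [Fintype V] [DecidableEq V]
  {R : Type*} [Field R] [LinearOrder R] [IsStrictOrderedRing R]

/-- **The fibrewise inequality on the far side**: for every up-set `𝓤`, the four far-side probabilities
of the cylinder argument with root `y` satisfy the anti-correlation (the far side alone is the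
cylinder class with the near side closed, `prob_zeroOff_eq_prob_sideEvent`). -/
theorem bside_anticorr (p : E → R) (hp : IsProbVec p) (ends : E → Sym2 V) (EB : Set E)
    [DecidablePred (· ∈ EB)] (y a₂ a₃ o : V) {𝓤 : Set (Set V)} (h𝓤 : IsUpperSet 𝓤) {B : Finset E}
    (hB : connEvent ends y a₃ = GateCylinder.cylinder B) :
    prob p (CutV.sideEvent EB ((connEvent ends y a₂)ᶜ ∩ clusterInEvent ends y 𝓤 ∩
        connEvent ends y a₃ ∩ connEvent ends a₂ o)) *
      prob p (CutV.sideEvent EB ((connEvent ends y a₂)ᶜ ∩ connEvent ends y a₃)) ≤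
    prob p (CutV.sideEvent EB ((connEvent ends y a₂)ᶜ ∩ clusterInEvent ends y 𝓤 ∩
        connEvent ends y a₃)) *
      prob p (CutV.sideEvent EB ((connEvent ends y a₂)ᶜ ∩ connEvent ends y a₃ ∩
        connEvent ends a₂ o)) := by
  rw [← prob_zeroOff_eq_prob_sideEvent, ← prob_zeroOff_eq_prob_sideEvent,
    ← prob_zeroOff_eq_prob_sideEvent, ← prob_zeroOff_eq_prob_sideEvent]
  exact CDCylinder.required_anticorr_of_cylinder _ (isProbVec_zeroOff hp EB) ends y a₂ a₃ o h𝓤 hB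

omit [Fintype V] [DecidableEq V] [LinearOrder R] [IsStrictOrderedRing R] in
/-- **Tower over the near side**: for an event of the form `{T ∈ eA ∧ restrict EB ω ∈ X T}` with
`T = restrict EA ω` the near-side configuration, the probability is the `p`-average over `ω` of
`1_{eA}(T) · P_p(far-side event X T)` (`expect_tower`, the two sides being independent). -/
theorem prob_eq_sum_tower (p : E → R) (EA EB : Set E) [DecidablePred (· ∈ EA)]
    [DecidablePred (· ∈ EB)] (hdisj : Disjoint EA EB) (eA : Set (Config E))
    (X : Config E → Set (Config E)) :
    prob p {ω | restrict EA ω ∈ eA ∧ restrict EB ω ∈ X (restrict EA ω)} =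
      ∑ ω, weight p ω * (eA.indicator 1 (restrict EA ω) *
        prob p (CutV.sideEvent EB (X (restrict EA ω)))) := by
  classical
  have hΦ : ∀ T : Config E, DependsOn
      (fun ω => eA.indicator (1 : Config E → R) T * (X T).indicator 1 (restrict EB ω)) EB := by
    intro T ω ω' h
    simp only [restrict_congr h]
  have hS : ∀ T : Config E, DependsOn (· ∈ {ω | restrict EA ω = T}) EA := by
    intro T ω ω' h
    simp only [Set.mem_setOf_eq, restrict_congr h]
  have htower := expect_tower p (F₁ := fun _ => EA) (F₂ := fun _ => EB) (fun _ => hdisj)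
    (S := restrict EA) hS
    (Φ := fun T ω => eA.indicator (1 : Config E → R) T * (X T).indicator 1 (restrict EB ω)) hΦ
  have hpt : ({ω | restrict EA ω ∈ eA ∧ restrict EB ω ∈ X (restrict EA ω)} :
      Set (Config E)).indicator (1 : Config E → R) =
      fun ω => eA.indicator 1 (restrict EA ω) * (X (restrict EA ω)).indicator 1 (restrict EB ω) := by
    funext ω
    by_cases h1 : restrict EA ω ∈ eA <;> by_cases h2 : restrict EB ω ∈ X (restrict EA ω) <;>
      simp [h1, h2]
  rw [prob_eq_expect_indicator, hpt, htower]
  refine Finset.sum_congr rfl fun ω _ => ?_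
  congr 1
  rw [expect_const_mul]
  congr 1
  exact (prob_eq_expect_indicator p (CutV.sideEvent EB (X (restrict EA ω)))).symm

variable {ends : E → Sym2 V} {y : V} {VA VB : Set V} {EA EB : Set E} [DecidablePred (· ∈ EA)]
  [DecidablePred (· ∈ EB)]

omit [Fintype E] [DecidableEq E] [Fintype V] [DecidableEq V] in
/-- Across the cut, for `u ∈ VA ∪ {y}` and `v ∈ VB ∪ {y}`: `u ↔ v` iff `u ↔ y` in `A` and `y ↔ v`
in `B` (`CutV.conn_across_iff` with the cut vertex itself allowed at either end). -/
lemma conn_iff_across_or_cut (h : CutV.IsCut ends y VA VB EA EB) {ω : Config E} {u v : V}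
    (hu : u ∈ VA ∪ {y}) (hv : v ∈ VB ∪ {y}) :
    Conn ends ω u v ↔ Conn ends (restrict EA ω) u y ∧ Conn ends (restrict EB ω) y v := by
  rcases hu with hu | hu
  · rcases hv with hv | hv
    · exact CutV.conn_across_iff h hu hv
    · rw [Set.mem_singleton_iff] at hv
      subst hv
      rw [CutV.conn_iff_restrict h (Or.inl hu) (Or.inr rfl)]
      exact ⟨fun hc => ⟨hc, conn_refl _ _ _⟩, fun hc => hc.1⟩
  · rw [Set.mem_singleton_iff] at hu
    subst hu
    rw [CutV.conn_iff_restrict h.symm (Or.inr rfl) hv]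
    exact ⟨fun hc => ⟨conn_refl _ _ _, hc⟩, fun hc => hc.2⟩

omit [Fintype E] [DecidableEq E] [Fintype V] [DecidableEq V] in
/-- The cluster of `u ∈ VA ∪ {y}` when `u ↔ y` in `A`: its `A`-side cluster together with the
`B`-side cluster of `y` (`CutV.cluster_eq_union`, with `u = y` allowed). -/
lemma cluster_eq_union_or_cut (h : CutV.IsCut ends y VA VB EA EB) {ω : Config E} {u : V}
    (hu : u ∈ VA ∪ {y}) (hx : Conn ends (restrict EA ω) u y) :
    cluster ends ω u = cluster ends (restrict EA ω) u ∪ cluster ends (restrict EB ω) y := by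
  rcases hu with hu | hu
  · exact CutV.cluster_eq_union h hu hx
  · rw [Set.mem_singleton_iff] at hu
    subst hu
    ext v
    constructor
    · intro hv
      rcases CutV.mem_union_of_conn h (Or.inr rfl) hv with (hvA | hvB) | hvx
      · exact Or.inl ((CutV.conn_iff_restrict h (Or.inr rfl) (Or.inl hvA)).mp hv)
      · exact Or.inr ((CutV.conn_iff_restrict h.symm (Or.inr rfl) (Or.inl hvB)).mp hv)
      · exact Or.inl ((CutV.conn_iff_restrict h (Or.inr rfl) (Or.inr hvx)).mp hv)
    · rintro (hv | hv)
      · exact conn_mono (restrict_le EA ω) hv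
      · exact conn_mono (restrict_le EB ω) hv

omit [Fintype E] [DecidableEq E] [Fintype V] [DecidableEq V] in
/-- The four `a₃`-required events across the cut, read on the two sides (the near-side event
`{a₁ ↔ y in A}`, the far-side events of the cylinder argument with root `y` and the up-set
`𝓔_T = {W ∣ C_A(a₁)(T) ∪ W ∈ 𝓔}`). -/
lemma required_events_eq (h : CutV.IsCut ends y VA VB EA EB) {a₁ a₂ a₃ o : V}
    (ha₁ : a₁ ∈ VA ∪ {y}) (ha₂ : a₂ ∈ VB) (ho : o ∈ VB) (ha₃ : a₃ ∈ VB ∪ {y}) (𝓔 : Set (Set V)) :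
    ((connEvent ends a₁ a₂)ᶜ ∩ clusterInEvent ends a₁ 𝓔 ∩ connEvent ends a₁ a₃ ∩
        connEvent ends a₂ o =
      {ω | restrict EA ω ∈ connEvent ends a₁ y ∧ restrict EB ω ∈
        ((connEvent ends y a₂)ᶜ ∩
          clusterInEvent ends y {W | cluster ends (restrict EA ω) a₁ ∪ W ∈ 𝓔} ∩
          connEvent ends y a₃ ∩ connEvent ends a₂ o)}) ∧
    ((connEvent ends a₁ a₂)ᶜ ∩ connEvent ends a₁ a₃ =
      {ω | restrict EA ω ∈ connEvent ends a₁ y ∧ restrict EB ω ∈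
        ((connEvent ends y a₂)ᶜ ∩ connEvent ends y a₃)}) ∧
    ((connEvent ends a₁ a₂)ᶜ ∩ clusterInEvent ends a₁ 𝓔 ∩ connEvent ends a₁ a₃ =
      {ω | restrict EA ω ∈ connEvent ends a₁ y ∧ restrict EB ω ∈
        ((connEvent ends y a₂)ᶜ ∩
          clusterInEvent ends y {W | cluster ends (restrict EA ω) a₁ ∪ W ∈ 𝓔} ∩
          connEvent ends y a₃)}) ∧
    ((connEvent ends a₁ a₂)ᶜ ∩ connEvent ends a₁ a₃ ∩ connEvent ends a₂ o =
      {ω | restrict EA ω ∈ connEvent ends a₁ y ∧ restrict EB ω ∈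
        ((connEvent ends y a₂)ᶜ ∩ connEvent ends y a₃ ∩ connEvent ends a₂ o)}) := by
  have hQe : ∀ ω : Config E, (¬ Conn ends ω a₁ a₂ ∧ Conn ends ω a₁ a₃) ↔
      (Conn ends (restrict EA ω) a₁ y ∧
        (¬ Conn ends (restrict EB ω) y a₂ ∧ Conn ends (restrict EB ω) y a₃)) := by
    intro ω
    rw [conn_iff_across_or_cut h ha₁ ha₃, conn_iff_across_or_cut h ha₁ (Or.inl ha₂)]
    tauto
  have hF : ∀ ω : Config E, Conn ends ω a₂ o ↔ Conn ends (restrict EB ω) a₂ o :=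
    fun ω => CutV.conn_iff_restrict h.symm (Or.inl ha₂) (Or.inl ho)
  have hU : ∀ ω : Config E, Conn ends (restrict EA ω) a₁ y →
      (cluster ends ω a₁ ∈ 𝓔 ↔
        cluster ends (restrict EA ω) a₁ ∪ cluster ends (restrict EB ω) y ∈ 𝓔) :=
    fun ω hx => by rw [cluster_eq_union_or_cut h ha₁ hx]
  refine ⟨?_, ?_, ?_, ?_⟩ <;> ext ω <;>
    simp only [Set.mem_inter_iff, Set.mem_compl_iff, mem_connEvent, mem_clusterInEvent,
      Set.mem_setOf_eq] <;>
    have h1 := hQe ω <;> have h2 := hF ω <;> have h3 := hU ω <;> tauto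

omit [Fintype V] [DecidableEq V] in
/-- `𝓔_T` is an up-set. -/
lemma isUpperSet_union_left {𝓔 : Set (Set V)} (h𝓔 : IsUpperSet 𝓔) (S : Set V) :
    IsUpperSet {W : Set V | S ∪ W ∈ 𝓔} :=
  fun _ _ hWW' hW => h𝓔 (Set.union_subset_union_right S hWW') hW

/-- **The `a₃`-required anti-correlation across a cut vertex with a far-side cylinder.** -/
theorem required_anticorr_of_cut_cylinder (p : E → R) (hp : IsProbVec p)
    (h : CutV.IsCut ends y VA VB EA EB) {a₁ a₂ a₃ o : V} (ha₁ : a₁ ∈ VA ∪ {y}) (ha₂ : a₂ ∈ VB)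
    (ho : o ∈ VB) (ha₃ : a₃ ∈ VB ∪ {y}) {𝓔 : Set (Set V)} (h𝓔 : IsUpperSet 𝓔) {B : Finset E}
    (hB : connEvent ends y a₃ = GateCylinder.cylinder B) :
    prob p ((connEvent ends a₁ a₂)ᶜ ∩ clusterInEvent ends a₁ 𝓔 ∩ connEvent ends a₁ a₃ ∩
          connEvent ends a₂ o) * prob p ((connEvent ends a₁ a₂)ᶜ ∩ connEvent ends a₁ a₃) ≤
      prob p ((connEvent ends a₁ a₂)ᶜ ∩ clusterInEvent ends a₁ 𝓔 ∩ connEvent ends a₁ a₃) *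
        prob p ((connEvent ends a₁ a₂)ᶜ ∩ connEvent ends a₁ a₃ ∩ connEvent ends a₂ o) := by
  obtain ⟨e1, e2, e3, e4⟩ := required_events_eq h ha₁ ha₂ ho ha₃ 𝓔
  have t1 := prob_eq_sum_tower p EA EB h.Edisj (connEvent ends a₁ y) (fun T =>
    (connEvent ends y a₂)ᶜ ∩ clusterInEvent ends y {W | cluster ends T a₁ ∪ W ∈ 𝓔} ∩
      connEvent ends y a₃ ∩ connEvent ends a₂ o)
  have t2 := prob_eq_sum_tower p EA EB h.Edisj (connEvent ends a₁ y) (fun _ =>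
    (connEvent ends y a₂)ᶜ ∩ connEvent ends y a₃)
  have t3 := prob_eq_sum_tower p EA EB h.Edisj (connEvent ends a₁ y) (fun T =>
    (connEvent ends y a₂)ᶜ ∩ clusterInEvent ends y {W | cluster ends T a₁ ∪ W ∈ 𝓔} ∩
      connEvent ends y a₃)
  have t4 := prob_eq_sum_tower p EA EB h.Edisj (connEvent ends a₁ y) (fun _ =>
    (connEvent ends y a₂)ᶜ ∩ connEvent ends y a₃ ∩ connEvent ends a₂ o)
  rw [e1, e3, e4, e2, t1, t3, t4, t2]
  set w : Config E → R := fun ω => weight p ω * (connEvent ends a₁ y).indicator 1 (restrict EA ω)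
    with hw
  have hw0 : ∀ ω, 0 ≤ w ω := fun ω =>
    mul_nonneg (weight_nonneg hp ω) (Set.indicator_apply_nonneg fun _ => zero_le_one)
  set Z := prob p (CutV.sideEvent EB ((connEvent ends y a₂)ᶜ ∩ connEvent ends y a₃)) with hZ
  set Zf := prob p (CutV.sideEvent EB ((connEvent ends y a₂)ᶜ ∩ connEvent ends y a₃ ∩
    connEvent ends a₂ o)) with hZf
  set X : Config E → R := fun ω => prob p (CutV.sideEvent EB ((connEvent ends y a₂)ᶜ ∩
    clusterInEvent ends y {W | cluster ends (restrict EA ω) a₁ ∪ W ∈ 𝓔} ∩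
    connEvent ends y a₃ ∩ connEvent ends a₂ o)) with hX
  set Y : Config E → R := fun ω => prob p (CutV.sideEvent EB ((connEvent ends y a₂)ᶜ ∩
    clusterInEvent ends y {W | cluster ends (restrict EA ω) a₁ ∪ W ∈ 𝓔} ∩
    connEvent ends y a₃)) with hY
  have hfib : ∀ ω, X ω * Z ≤ Y ω * Zf := fun ω =>
    bside_anticorr p hp ends EB y a₂ a₃ o (isUpperSet_union_left h𝓔 _) hB
  have hS0 : 0 ≤ ∑ ω, w ω := Finset.sum_nonneg fun ω _ => hw0 ω
  have sa : ∑ ω, weight p ω * ((connEvent ends a₁ y).indicator 1 (restrict EA ω) * X ω) =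
      ∑ ω, w ω * X ω := Finset.sum_congr rfl fun ω _ => by rw [hw]; ring
  have sb : ∑ ω, weight p ω * ((connEvent ends a₁ y).indicator 1 (restrict EA ω) * Y ω) =
      ∑ ω, w ω * Y ω := Finset.sum_congr rfl fun ω _ => by rw [hw]; ring
  have sd : ∑ ω, weight p ω * ((connEvent ends a₁ y).indicator 1 (restrict EA ω) * Z) =
      (∑ ω, w ω) * Z := by
    rw [Finset.sum_mul]; exact Finset.sum_congr rfl fun ω _ => by rw [hw]; ring
  have sc : ∑ ω, weight p ω * ((connEvent ends a₁ y).indicator 1 (restrict EA ω) * Zf) =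
      (∑ ω, w ω) * Zf := by
    rw [Finset.sum_mul]; exact Finset.sum_congr rfl fun ω _ => by rw [hw]; ring
  show (∑ ω, weight p ω * ((connEvent ends a₁ y).indicator 1 (restrict EA ω) * X ω)) *
      (∑ ω, weight p ω * ((connEvent ends a₁ y).indicator 1 (restrict EA ω) * Z)) ≤
    (∑ ω, weight p ω * ((connEvent ends a₁ y).indicator 1 (restrict EA ω) * Y ω)) *
      (∑ ω, weight p ω * ((connEvent ends a₁ y).indicator 1 (restrict EA ω) * Zf))
  rw [sa, sb, sc, sd]
  have hsum : ∑ ω, w ω * (X ω * Z) ≤ ∑ ω, w ω * (Y ω * Zf) :=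
    Finset.sum_le_sum fun ω _ => mul_le_mul_of_nonneg_left (hfib ω) (hw0 ω)
  have hXZ : ∑ ω, w ω * (X ω * Z) = (∑ ω, w ω * X ω) * Z := by
    rw [Finset.sum_mul]; exact Finset.sum_congr rfl fun ω _ => by ring
  have hYZ : ∑ ω, w ω * (Y ω * Zf) = (∑ ω, w ω * Y ω) * Zf := by
    rw [Finset.sum_mul]; exact Finset.sum_congr rfl fun ω _ => by ring
  rw [hXZ, hYZ] at hsum
  calc (∑ ω, w ω * X ω) * ((∑ ω, w ω) * Z) = ((∑ ω, w ω * X ω) * Z) * ∑ ω, w ω := by ring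
    _ ≤ ((∑ ω, w ω * Y ω) * Zf) * ∑ ω, w ω := mul_le_mul_of_nonneg_right hsum hS0
    _ = (∑ ω, w ω * Y ω) * ((∑ ω, w ω) * Zf) := by ring

/-- **Row 2′CD across a cut vertex with a far-side cylinder.** `y` a cut vertex separating `a₁ ∈ VA`
from `a₂, o ∈ VB`, and `a₃ ∈ VB ∪ {y}` with `{y ↔ a₃}` a cylinder (`a₃ = y`, or `a₃` joined to `y` by a
unique path of bridges): for every up-set `𝓔` and every weight vector,
`P(Q N)·(P(Q)P(Q U e f) − P(Q U)P(Q e f)) ≤ P(Q N oU)·(P(Q)P(Q U e) − P(Q U)P(Q e))`. -/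
theorem cd_of_cut_cylinder (p : E → R) (hp : IsProbVec p) (h : CutV.IsCut ends y VA VB EA EB)
    {a₁ a₂ a₃ o : V} (ha₁ : a₁ ∈ VA ∪ {y}) (ha₂ : a₂ ∈ VB) (ho : o ∈ VB) (ha₃ : a₃ ∈ VB ∪ {y})
    {𝓔 : Set (Set V)} (h𝓔 : IsUpperSet 𝓔) {B : Finset E}
    (hB : connEvent ends y a₃ = GateCylinder.cylinder B) :
    let Q := (connEvent ends a₁ a₂)ᶜ
    let U := clusterInEvent ends a₁ 𝓔
    let e := connEvent ends a₁ a₃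
    let f := connEvent ends a₂ o
    let N := (connEvent ends a₁ a₃)ᶜ ∩ (connEvent ends a₂ a₃)ᶜ
    let oU := connEvent ends a₁ o ∪ connEvent ends a₂ o
    prob p (Q ∩ N) * (prob p Q * prob p (Q ∩ U ∩ e ∩ f) - prob p (Q ∩ U) * prob p (Q ∩ e ∩ f)) ≤
      prob p (Q ∩ N ∩ oU) * (prob p Q * prob p (Q ∩ U ∩ e) - prob p (Q ∩ U) * prob p (Q ∩ e)) :=
  CDRequired.cd_of_required_anticorr p hp ends a₁ a₂ a₃ o h𝓔
    (required_anticorr_of_cut_cylinder p hp h ha₁ ha₂ ho ha₃ h𝓔 hB)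

omit [Fintype E] [DecidableEq E] [Fintype V] [DecidableEq V] in
/-- `{y ↔ y}` is the empty cylinder. -/
lemma connEvent_self_eq_cylinder_empty (ends : E → Sym2 V) (y : V) :
    connEvent ends y y = GateCylinder.cylinder (∅ : Finset E) := by
  ext ω
  simp [GateCylinder.cylinder, conn_refl]

/-- **Row 2′CD when `a₃` is a cut vertex separating `a₁` from `{a₂, o}`** (the case `a₃ = y`). -/
theorem cd_of_cut_vertex (p : E → R) (hp : IsProbVec p) (h : CutV.IsCut ends y VA VB EA EB)
    {a₁ a₂ o : V} (ha₁ : a₁ ∈ VA ∪ {y}) (ha₂ : a₂ ∈ VB) (ho : o ∈ VB) {𝓔 : Set (Set V)}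
    (h𝓔 : IsUpperSet 𝓔) :
    let Q := (connEvent ends a₁ a₂)ᶜ
    let U := clusterInEvent ends a₁ 𝓔
    let e := connEvent ends a₁ y
    let f := connEvent ends a₂ o
    let N := (connEvent ends a₁ y)ᶜ ∩ (connEvent ends a₂ y)ᶜ
    let oU := connEvent ends a₁ o ∪ connEvent ends a₂ o
    prob p (Q ∩ N) * (prob p Q * prob p (Q ∩ U ∩ e ∩ f) - prob p (Q ∩ U) * prob p (Q ∩ e ∩ f)) ≤
      prob p (Q ∩ N ∩ oU) * (prob p Q * prob p (Q ∩ U ∩ e) - prob p (Q ∩ U) * prob p (Q ∩ e)) :=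
  cd_of_cut_cylinder p hp h ha₁ ha₂ ho (Or.inr rfl) h𝓔 (connEvent_self_eq_cylinder_empty ends y)

/-- **Row 2′CD when the root `a₁ = y` itself is the cut vertex** (the near side is idle): `a₂, o` and `a₃`
on the far side, `{a₁ ↔ a₃}` a cylinder there — any up-set, any weight vector. -/
theorem cd_of_cut_at_root (p : E → R) (hp : IsProbVec p) (h : CutV.IsCut ends y VA VB EA EB)
    {a₂ a₃ o : V} (ha₂ : a₂ ∈ VB) (ho : o ∈ VB) (ha₃ : a₃ ∈ VB ∪ {y}) {𝓔 : Set (Set V)}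
    (h𝓔 : IsUpperSet 𝓔) {B : Finset E} (hB : connEvent ends y a₃ = GateCylinder.cylinder B) :
    let Q := (connEvent ends y a₂)ᶜ
    let U := clusterInEvent ends y 𝓔
    let e := connEvent ends y a₃
    let f := connEvent ends a₂ o
    let N := (connEvent ends y a₃)ᶜ ∩ (connEvent ends a₂ a₃)ᶜ
    let oU := connEvent ends y o ∪ connEvent ends a₂ o
    prob p (Q ∩ N) * (prob p Q * prob p (Q ∩ U ∩ e ∩ f) - prob p (Q ∩ U) * prob p (Q ∩ e ∩ f)) ≤
      prob p (Q ∩ N ∩ oU) * (prob p Q * prob p (Q ∩ U ∩ e) - prob p (Q ∩ U) * prob p (Q ∩ e)) :=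
  cd_of_cut_cylinder p hp h (Or.inr rfl) ha₂ ho ha₃ h𝓔 hB

end Main

end CDCutVertex

end Summit.Ventures.PercRepro2
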